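import Summits.PneNP.PneNP.Theses.ExpanderLinearGenerators
import Summits.PneNP.PneNP.Theses.AperiodicTorus
import Summits.PneNP.PneNP.Theses.MatroidTseitin
import Summits.PneNP.PneNP.Theorems.ExpanderLinearGeneratorsTautBridgeTerm

/-!
# PneNP / ExpanderLinearGenerators (and AperiodicTorus, MatroidTseitin) — assembly

Item `stmt-PneNP-10718` (assembly, shared by the three routes `route-PneNP-ExpanderLinearGenerators`,
`route-PneNP-AperiodicTorus`, `route-PneNP-MatroidTseitin`): in each route
`Assembly := NoPolyBoundedProofSystem → TautBridge → PneNP` where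
`TautBridge := ¬ HasPolyBoundedProofSystem TAUT → PneNP` and
`NoPolyBoundedProofSystem := ¬ HasPolyBoundedProofSystem TAUT` (the shared target `stmt-PneNP-0097`,
Cook–Reckhow's form of `NP ≠ coNP`). The assembly is modus ponens — literally the type of each
route's deciding theorem `closes (hX) (hB) := hB hX`.

Prover prover-PneNP-route-PneNP-ExpanderLinearGenerators-1, 2026-08-16 (candidate one-liners were
attached to the item by several refuters/grounders on 2026-08-15; this file lands them against the
built route modules).

**Repair 2026-08-16 (route revs of 09:56Z / 09:58Z / 10:28Z).** Routes ExpanderLinearGenerators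
(rev 6, item stmt-PneNP-15165), MatroidTseitin (item stmt-PneNP-15169) and AperiodicTorus (item
stmt-PneNP-15165, shared) restated their item UNDER THE SAME DECL NAME `Assembly` as the 2-ary
`NoPolyBoundedProofSystem → PneNP` (the bridge inlined), so the modus-ponens proofs
`fun hX hB => hB hX` of all three theorems below stopped elaborating ("Type mismatch"). The
theorems keep their names (Theorems files are append-only) and now prove the current `Assembly` of
their route through the cycle-free, conjecture-free term theorem
`Summit.PneNP.PneNP.Theorems.pneNP_of_not_hasPolyBoundedProofSystem_TAUT`
(`Theorems/ExpanderLinearGeneratorsTautBridgeTerm.lean`: Cook–Reckhow 1979 Prop. 1.1/1.4 over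
`CookBridges` / `TautMachine` / `ProofSystemsProofs`). They are second, dependent proofs: the
rev-6 ExpanderLinearGenerators assembly is closed by
`Theorems.expanderLinearGenerators_assembly_rev6_proof`
(`Theorems/ExpanderLinearGeneratorsAssemblyRev6.lean`, which closed stmt-PneNP-15165), and route
MatroidTseitin asks for a closing file importing only its own route module, which this module
(importing three route files) is not.
-/

set_option linter.dupNamespace false

namespace Summit.PneNP.PneNP.Theorems

/-- Settles `stmt-PneNP-10718` for route ExpanderLinearGenerators: the target `X = ¬ p-bounded pps for
TAUT` and the model bridge `X → PneNP` give Cook's statement, by modus ponens. Since route rev 6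
(2026-08-16, item stmt-PneNP-15165) the statement is the 2-ary `NoPolyBoundedProofSystem → PneNP`
(same decl name; see the module docstring), proved by the conjecture-free bridge
`pneNP_of_not_hasPolyBoundedProofSystem_TAUT` (Cook–Reckhow 1979, Prop. 1.1/1.4). [folklore] -/
theorem expanderLinearGenerators_assembly_proof :
    Summit.PneNP.PneNP.Theses.ExpanderLinearGenerators.Assembly := by
  unfold Summit.PneNP.PneNP.Theses.ExpanderLinearGenerators.Assembly
    Summit.PneNP.PneNP.Theses.ExpanderLinearGenerators.NoPolyBoundedProofSystem
  -- rev ≥ 6: `Assembly` is `NoPolyBoundedProofSystem → PneNP`; the bridge is proved.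
  exact pneNP_of_not_hasPolyBoundedProofSystem_TAUT

/-- Settles `stmt-PneNP-10718` for route AperiodicTorus (same signature, same argument: modus
ponens of the bridge on the target). Since the AperiodicTorus restatement of 2026-08-16T10:28Z
(item stmt-PneNP-15165, shared with ExpanderLinearGenerators) the statement is the 2-ary
`NoPolyBoundedProofSystem → PneNP` (same decl name; see the module docstring), proved by the
conjecture-free bridge `pneNP_of_not_hasPolyBoundedProofSystem_TAUT` (Cook–Reckhow 1979,
Prop. 1.1/1.4). [folklore] -/
theorem aperiodicTorus_assembly_proof :
    Summit.PneNP.PneNP.Theses.AperiodicTorus.Assembly := by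
  unfold Summit.PneNP.PneNP.Theses.AperiodicTorus.Assembly
    Summit.PneNP.PneNP.Theses.AperiodicTorus.NoPolyBoundedProofSystem
  -- 2-ary since 2026-08-16T10:28Z: `Assembly` is `NoPolyBoundedProofSystem → PneNP`.
  exact pneNP_of_not_hasPolyBoundedProofSystem_TAUT

/-- Settles `stmt-PneNP-10718` for route MatroidTseitin (same signature, same argument: modus
ponens of the bridge on the target). Since the MatroidTseitin cone repair of 2026-08-16 (item
stmt-PneNP-15169) the statement is the 2-ary `NoPolyBoundedProofSystem → PneNP` (same decl name;
see the module docstring), proved by the conjecture-free bridge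
`pneNP_of_not_hasPolyBoundedProofSystem_TAUT` (Cook–Reckhow 1979, Prop. 1.1/1.4); a dependent
second proof only — the route's closing file imports its own route module alone. [folklore] -/
theorem matroidTseitin_assembly_proof :
    Summit.PneNP.PneNP.Theses.MatroidTseitin.Assembly := by
  unfold Summit.PneNP.PneNP.Theses.MatroidTseitin.Assembly
    Summit.PneNP.PneNP.Theses.MatroidTseitin.NoPolyBoundedProofSystem
  -- 2-ary since 2026-08-16T09:58Z: `Assembly` is `NoPolyBoundedProofSystem → PneNP`.
  exact pneNP_of_not_hasPolyBoundedProofSystem_TAUT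

end Summit.PneNP.PneNP.Theorems
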